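import Summits.ABC.StewartYu.ShapeRouteRungs
import Summits.ABC.ABC.Theses.YuMatveevShapeRat
import HarnessLib

set_option linter.dupNamespace false

/-!
# Route YuMatveevShapeRat (rung F-A1.L): the T3/BC5 WITNESSES under the route slug, EXPLICIT-constant form

`Summits/ABC/ABC/Theorems/YuMatveevShapeRatRungs.lean` — cell `abc-stewartyu`, seat p4 (g9, closer seat), on
planner g11's ask (STATUS 2026-08-27T15:15:08Z).  Born-mode tribunal probes import only the route module and the
slug's own `Theorems/YuMatveevShapeRat*` files, so the T3/BC5 witnesses must live here.  Each theorem below is the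
corresponding crux text of the route (`PadicCoreOddRat`, stmt-ABC-20503 / `PadicCoreTwoRat`, stmt-ABC-20504) with
ONE extra Kummer clause and with the existential constant `c` INSTANTIATED (`c = 2 ^ 100`, resp. `c = 2 ^ 110`) — a
proved special case (the Kummer regime) from the landed A1.M3 engines `YuOhSeven.coreOdd_two_pow_100` /
`coreTwo_two_pow_110` (REF-AUDIT-31 §9); the `∃ c` forms are `Summit.ABC.StewartYu.padicCoreOddRat_kummerRung` /
`…padicCoreTwoRat_kummerRung` (`Summits/ABC/StewartYu/ShapeRouteRungs.lean`, p538467), of which these are the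
explicit strengthenings.
WHAT THIS IS NOT: a crux or route text change; no rung motion.
-/

open Finset

namespace Summit.ABC.ABC.Theorems

/-- **T3 witness of route `YuMatveevShapeRat` (crux `PadicCoreOddRat`, stmt-ABC-20503), explicit constant**: the
crux text for odd primes `p` with the extra signed 2-Kummer hypothesis on `θ` and `c := 2 ^ 100` substituted
(`YuOhSeven.coreOdd_two_pow_100`). [cite: Yu2007, Main Thm (K = ℚ); shape only] -/
theorem yuMatveevShapeRat_rung_odd (p : ℕ) (hp : p.Prime) (hp2 : p ≠ 2)
    (r : ℕ) (θ : Fin r → ℚ) (m : Fin r → ℤ) (A : Fin r → ℝ) (Amax W : ℝ)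
    (hu : ∀ i, θ i ≠ 0 ∧ padicValRat p (θ i) = 0)
    (hind : ∀ μ : Fin r → ℤ, ∏ i, θ i ^ μ i = 1 → μ = 0)
    (hK : ∀ κ : Fin r → ℤ, (∃ γ : ℚ, ∏ i, θ i ^ κ i = γ ^ 2 ∨ ∏ i, θ i ^ κ i = -γ ^ 2) →
      ∀ i, (2 : ℤ) ∣ κ i)
    (hA : ∀ i, Height.logHeight₁ (θ i) ≤ A i) (hA1 : ∀ i, 1 ≤ A i) (hAm : ∀ i, A i ≤ Amax)
    (hm : m ≠ 0) (hW : ∀ i, Real.log (max 3 (|m i| : ℝ)) ≤ W) (hW1 : 1 ≤ W) :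
    (padicValRat p (∏ i, θ i ^ m i - 1) : ℝ) * Real.log p ≤
      ((2 : ℝ) ^ 100) ^ r * ((p : ℝ) / Real.log p) * (∏ i, A i) * (W + Real.log p + Real.log (2 * Amax)) := by
  haveI : Fact p.Prime := ⟨hp⟩
  exact Summit.ABC.StewartYu.YuOhSeven.coreOdd_two_pow_100 p hp2 r θ m A Amax W hu hind hK hA hA1 hAm hm hW hW1

/-- **T3 witness of route `YuMatveevShapeRat` (crux `PadicCoreTwoRat`, stmt-ABC-20504), explicit constant**: the
crux text at `p = 2` with the extra 3-Kummer hypothesis on `θ` and `c := 2 ^ 110` substituted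
(`YuOhSeven.coreTwo_two_pow_110`). [cite: Yu2007, Main Thm (K = ℚ, ℘ = 2); shape only] -/
theorem yuMatveevShapeRat_rung_two (r : ℕ) (θ : Fin r → ℚ) (m : Fin r → ℤ) (A : Fin r → ℝ) (Amax W : ℝ)
    (hu : ∀ i, 3 ≤ padicValRat 2 (θ i - 1))
    (hind : ∀ μ : Fin r → ℤ, ∏ i, θ i ^ μ i = 1 → μ = 0)
    (hK : ∀ κ : Fin r → ℤ, (∃ γ : ℚ, ∏ i, θ i ^ κ i = γ ^ 3) → ∀ i, (3 : ℤ) ∣ κ i)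
    (hA : ∀ i, Height.logHeight₁ (θ i) ≤ A i) (hA1 : ∀ i, 1 ≤ A i) (hAm : ∀ i, A i ≤ Amax)
    (hm : m ≠ 0) (hW : ∀ i, Real.log (max 3 (|m i| : ℝ)) ≤ W) (hW1 : 1 ≤ W) :
    (padicValRat 2 (∏ i, θ i ^ m i - 1) : ℝ) ≤ ((2 : ℝ) ^ 110) ^ r * (∏ i, A i) * (W + Real.log (2 * Amax)) := by
  have h := Summit.ABC.StewartYu.YuOhSeven.coreTwo_two_pow_110 r θ m A Amax W hu hind hK hA hA1 hAm hm hW hW1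
  have hc : ((2 : ℝ) ^ 110) ^ r = (2 : ℝ) ^ (110 * r) := by rw [← pow_mul]
  rw [hc]; exact h

/-- The route's crux `PadicCoreOddRat` IMPLIED by its own Kummer-free form is trivial; recorded here is the converse
direction available today: the crux text's `∃ c` form WITH the Kummer clause, from the explicit witness (so the
slug carries a statement mentioning the shape of `Summit.ABC.ABC.Theses.YuMatveevShapeRat.PadicCoreOddRat` up to
one hypothesis). [cite: Yu2007, Main Thm (K = ℚ); shape only] -/
theorem yuMatveevShapeRat_rung_odd_exists : ∃ c : ℝ, 1 ≤ c ∧ ∀ (p : ℕ), p.Prime → p ≠ 2 →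
    ∀ (r : ℕ) (θ : Fin r → ℚ) (m : Fin r → ℤ) (A : Fin r → ℝ) (Amax W : ℝ),
      (∀ i, θ i ≠ 0 ∧ padicValRat p (θ i) = 0) →
      (∀ μ : Fin r → ℤ, ∏ i, θ i ^ μ i = 1 → μ = 0) →
      (∀ κ : Fin r → ℤ, (∃ γ : ℚ, ∏ i, θ i ^ κ i = γ ^ 2 ∨ ∏ i, θ i ^ κ i = -γ ^ 2) →
        ∀ i, (2 : ℤ) ∣ κ i) →
      (∀ i, Height.logHeight₁ (θ i) ≤ A i) → (∀ i, 1 ≤ A i) → (∀ i, A i ≤ Amax) →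
      m ≠ 0 → (∀ i, Real.log (max 3 (|m i| : ℝ)) ≤ W) → 1 ≤ W →
      (padicValRat p (∏ i, θ i ^ m i - 1) : ℝ) * Real.log p ≤
        c ^ r * ((p : ℝ) / Real.log p) * (∏ i, A i) * (W + Real.log p + Real.log (2 * Amax)) :=
  ⟨(2 : ℝ) ^ 100, by norm_num, yuMatveevShapeRat_rung_odd⟩

end Summit.ABC.ABC.Theorems
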